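import Literature.Analysis.FluidPDE.PassiveScalarDiagForcedExistence
import Literature.Analysis.FluidPDE.PassiveScalarDiagUniqueness
import Literature.Analysis.FluidPDE.PassiveScalarDiagEnergyContinuity
import HarnessLib

/-!
# Global-in-time existence of strongly `L²`-continuous weak solutions of the FORCED passive scalar
  equation with constant diagonal diffusion and bounded drift on `T^d`

Analysis/FluidPDE proof file (everything proved). The GLOBAL companion of
`PassiveScalarDiagForcedExistence`: for `κ > 0`, `aᵢ > 0`, `θ₀ ∈ L²(T^d)`, a velocity field bounded
on every slab `(0,T) × T^d` and weakly divergence free at a.e. time, and a source square integrable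
on every slab (e.g. a steady `L²` source), there is a GLOBAL weak solution
`Torus.IsWeakScalarTransportDiagForced a κ u s θ₀ θ` (a weak solution on `T^d × [0,T)` for every
`T > 0`) which is the `L²`-continuous representative on `[0,∞)` (`Torus.IsL2ContinuousOn (Ici 0) θ`)
with `θ 0 = θ₀` — `Torus.exists_isWeakScalarTransportDiagForced_l2Continuous`, with the steady-source
/ bounded-carrier corollary `Torus.exists_isWeakScalarTransportDiagForced_l2Continuous_of_steady`
(the class over which the scalar zeroth-law statements for Hess-Childs–Rowan carriers quantify; this
file is their non-vacuity certificate).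

Proof: GLUING of the local solutions `θₙ` on `[0,n+1]` (`exists_isWeakScalarTransportDiagForcedOn_l2Continuous`)
along `θ(t) = θ_{⌊t⌋}(t)`. By uniqueness in `L^∞_t L²_x` for bounded drifts
(`IsWeakScalarTransportDiagForcedOn.ae_eq_of_memLp_top`, Bonicatto–Ciampa–Crippa 2024 Cor. 3.5) two
local solutions agree at a.e. common time, and two `L²`-CONTINUOUS fields agreeing at a.e. time agree
at EVERY time (`IsL2ContinuousOn.ae_eq_slice_of_ae`: weak continuity of the pairings with smooth
fields, `Measure.eqOn_Icc_of_ae_eq`, and Fourier uniqueness); hence the glued field is a.e.-slicewise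
equal to `θ_N` on `[0,N+1]`, so it is a weak solution on every horizon (`congr_ae_slice`) and
`L²`-continuous on `[0,∞)`.

## References

* A. Pazy, *Semigroups of Linear Operators and Applications to PDE*, Springer 1983, Ch. 4 §4.2
  Cor. 2.5, Ch. 6 §6.1 Thm. 1.2 (global mild solutions by continuation).
* P. Bonicatto, G. Ciampa, G. Crippa, J. Math. Pures Appl. (2024), Cor. 3.5 (uniqueness, bounded drift).
* R. J. DiPerna, P.-L. Lions, Invent. Math. 98 (1989) 511–547, §II.1.
-/

noncomputable section

open MeasureTheory TopologicalSpace Set Function Filter UnitAddTorus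
open _root_.Topology
open scoped ENNReal NNReal InnerProductSpace ComplexConjugate

namespace Literature.Analysis.FluidPDE

namespace Torus

open Literature.Analysis.FunctionSpaces.Torus Literature.Analysis.FunctionSpaces

variable {d : Type*} [Fintype d]

section Global

variable [DecidableEq d]
variable {T κ : ℝ} {a : d → ℝ} {u : ℝ → UnitAddTorus d → EuclideanSpace ℝ d}
  {s : ℝ → UnitAddTorus d → ℝ} {θ₀ : UnitAddTorus d → ℝ} {θ₁ θ₂ : ℝ → UnitAddTorus d → ℝ}

omit [DecidableEq d] in
/-- **Two `L²`-continuous fields on `[0,T]` which agree at almost every time agree at every time**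
(as elements of `L²`): the pairings `t ↦ ∫ θᵢ(t) g` with a smooth `g` are continuous on `[0,T]`
(`IsL2ContinuousOn.continuousOn_integral_mul`) and agree a.e., hence everywhere
(`Measure.eqOn_Icc_of_ae_eq`); equal pairings against all smooth fields force `θ₁(t) = θ₂(t)` a.e.
(Fourier uniqueness, `ae_eq_of_forall_integral_mul_smooth_eq`). [cite: Grafakos2014, Prop. 3.2.4] -/
theorem IsL2ContinuousOn.ae_eq_slice_of_ae (hT : 0 < T) (h₁ : IsL2ContinuousOn (Icc 0 T) θ₁)
    (h₂ : IsL2ContinuousOn (Icc 0 T) θ₂)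
    (hae : ∀ᵐ t ∂((volume : Measure ℝ).restrict (Ioo 0 T)), θ₁ t =ᵐ[volume] θ₂ t) :
    ∀ t ∈ Icc 0 T, θ₁ t =ᵐ[volume] θ₂ t := by
  intro t ht
  refine ae_eq_of_forall_integral_mul_smooth_eq ((h₁.memLp ht).integrable one_le_two)
    ((h₂.memLp ht).integrable one_le_two) fun g hg => ?_
  have hF₁ := h₁.continuousOn_integral_mul (hg.memLp 2)
  have hF₂ := h₂.continuousOn_integral_mul (hg.memLp 2)
  have hae' : (fun t => ∫ x, θ₁ t x * g x) =ᵐ[(volume : Measure ℝ).restrict (Icc 0 T)]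
      fun t => ∫ x, θ₂ t x * g x := by
    rw [← Measure.restrict_congr_set (Ioo_ae_eq_Icc (μ := (volume : Measure ℝ)))]
    filter_upwards [hae] with τ hτ
    exact integral_congr_ae (hτ.mono fun x hx => by dsimp only; rw [hx])
  exact Measure.eqOn_Icc_of_ae_eq (μ := volume) hT.ne hae' hF₁ hF₂ ht

/-- **Global existence of a strongly `L²`-continuous weak solution of the FORCED passive scalar
equation with constant diagonal diffusion and bounded drift.** For `κ > 0`, coefficients `aᵢ > 0`,
an `L²` datum `θ₀`, a velocity field `u` with `u ∈ L^∞((0,T) × T^d)` for every `T` and weakly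
divergence free at a.e. time, and a source `s` with `s ∈ L²((0,T) × T^d)` for every `T`, there is a
GLOBAL weak solution `θ` of `∂ₜθ + u·∇θ = κ ∑ᵢ aᵢ ∂ᵢ∂ᵢθ + s` with datum `θ₀`
(`Torus.IsWeakScalarTransportDiagForced a κ u s θ₀ θ`: a weak solution on `T^d × [0,T)` for every
`T > 0`) which is the `L²`-CONTINUOUS representative on `[0,∞)` (`Torus.IsL2ContinuousOn (Ici 0) θ`)
with `θ 0 = θ₀`. Proof: gluing of the local mild solutions `θₙ` on `[0,n+1]`
(`exists_isWeakScalarTransportDiagForcedOn_l2Continuous`, Pazy 1983 Ch. 4 Cor. 2.5) along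
`θ(t) = θ_{⌊t⌋}(t)`, consistent by uniqueness for bounded drifts (Bonicatto–Ciampa–Crippa 2024,
Cor. 3.5) upgraded to every time by `L²` continuity.
[cite: Pazy1983, Ch. 4 §4.2, Cor. 2.5 (inhomogeneous problem), p. 107; BonicattoCiampaCrippa2023, Cor. 3.5 (case p = ∞, q = 2)] -/
theorem exists_isWeakScalarTransportDiagForced_l2Continuous (hκ : 0 < κ) (ha : ∀ i, 0 < a i)
    (hθ₀ : MemLp θ₀ 2 volume)
    (hu : ∀ T : ℝ, MemLp (stLift u) ∞ (volume.restrict (Ioo 0 T ×ˢ univ)))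
    (hdiv : ∀ T : ℝ, ∀ᵐ t ∂((volume : Measure ℝ).restrict (Ioo 0 T)), FunctionSpaces.Torus.IsWeaklyDivFree (u t))
    (hs : ∀ T : ℝ, MemLp (uncurry s) 2 (((volume : Measure ℝ).restrict (Ioo 0 T)).prod volume)) :
    ∃ θ : ℝ → UnitAddTorus d → ℝ, IsWeakScalarTransportDiagForced a κ u s θ₀ θ ∧
      IsL2ContinuousOn (Ici 0) θ ∧ θ 0 = θ₀ := by
  -- local solutions on `[0, n+1]`
  have hloc : ∀ n : ℕ, ∃ θ : ℝ → UnitAddTorus d → ℝ,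
      IsWeakScalarTransportDiagForcedOn ((n : ℝ) + 1) a κ u s θ₀ θ ∧
        IsL2ContinuousOn (Icc 0 ((n : ℝ) + 1)) θ ∧ θ 0 = θ₀ := fun n =>
    exists_isWeakScalarTransportDiagForcedOn_l2Continuous hκ ha hθ₀ (hu _) (hdiv _) (hs _)
  choose Θ hsol hcont h0 using hloc
  -- pairwise agreement at EVERY time of the common interval
  have hagree : ∀ n N : ℕ, n ≤ N → ∀ t ∈ Icc 0 ((n : ℝ) + 1), Θ n t =ᵐ[volume] Θ N t := by
    intro n N hnN
    have hle : (n : ℝ) + 1 ≤ (N : ℝ) + 1 := by exact_mod_cast Nat.succ_le_succ hnN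
    have hae := IsWeakScalarTransportDiagForcedOn.ae_eq_of_memLp_top hκ ha (hsol n) ((hsol N).mono hle) (hu _)
    exact IsL2ContinuousOn.ae_eq_slice_of_ae (by positivity) (hcont n)
      ((hcont N).mono (Icc_subset_Icc_right hle)) hae
  -- the glued field
  set θ : ℝ → UnitAddTorus d → ℝ := fun t => Θ ⌊t⌋₊ t with hθdef
  have hθN : ∀ N : ℕ, ∀ t ∈ Icc 0 ((N : ℝ) + 1), θ t =ᵐ[volume] Θ N t := by
    intro N t ht
    have htf : t ∈ Icc 0 ((⌊t⌋₊ : ℝ) + 1) := ⟨ht.1, (Nat.lt_floor_add_one t).le⟩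
    rcases le_or_gt ⌊t⌋₊ N with hle | hlt
    · exact hagree ⌊t⌋₊ N hle t htf
    · -- then `⌊t⌋₊ = N + 1 = t`
      have h1 : (N : ℝ) + 1 ≤ ⌊t⌋₊ := by exact_mod_cast hlt
      have h2 : (⌊t⌋₊ : ℝ) ≤ t := Nat.floor_le ht.1
      exact (hagree N ⌊t⌋₊ hlt.le t ht).symm
  -- the glued field agrees a.e.-slicewise with `Θ N` on `(0,T)`, `T ≤ N+1`
  have hθae : ∀ {T : ℝ} (N : ℕ), T ≤ (N : ℝ) + 1 →
      ∀ᵐ t ∂((volume : Measure ℝ).restrict (Ioo 0 T)), θ t =ᵐ[volume] Θ N t := by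
    intro T N hTN
    filter_upwards [ae_restrict_mem measurableSet_Ioo] with t ht
    exact hθN N t ⟨ht.1.le, ht.2.le.trans hTN⟩
  -- measurability of the glued field on every slab
  have hmeas : ∀ T : ℝ, AEStronglyMeasurable (stLift θ) (volume.restrict (Ioo 0 T ×ˢ univ)) := by
    intro T
    have hcover : Ioo 0 T ×ˢ (univ : Set (EuclideanSpace ℝ d)) =
        ⋃ n : ℕ, (Ioo 0 T ∩ Ico (n : ℝ) ((n : ℝ) + 1)) ×ˢ (univ : Set (EuclideanSpace ℝ d)) := by
      ext ⟨t, y⟩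
      simp only [mem_prod, mem_univ, and_true, mem_iUnion, mem_inter_iff, mem_Ico]
      constructor
      · intro ht
        exact ⟨⌊t⌋₊, ht, Nat.floor_le ht.1.le, Nat.lt_floor_add_one t⟩
      · rintro ⟨n, ht, -⟩
        exact ht
    rw [hcover, aestronglyMeasurable_iUnion_iff]
    intro n
    have hsub : (Ioo 0 T ∩ Ico (n : ℝ) ((n : ℝ) + 1)) ×ˢ (univ : Set (EuclideanSpace ℝ d)) ⊆
        Ioo 0 ((n : ℝ) + 1) ×ˢ univ :=
      prod_mono (fun t ht => ⟨ht.1.1, ht.2.2⟩) subset_rfl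
    have hn : AEStronglyMeasurable (stLift (Θ n))
        (volume.restrict ((Ioo 0 T ∩ Ico (n : ℝ) ((n : ℝ) + 1)) ×ˢ (univ : Set (EuclideanSpace ℝ d)))) :=
      (hsol n).aestronglyMeasurable.mono_measure (Measure.restrict_mono hsub le_rfl)
    refine hn.congr ?_
    filter_upwards [ae_restrict_mem ((measurableSet_Ioo.inter measurableSet_Ico).prod MeasurableSet.univ)]
      with p hp
    have hp1 : p.1 ∈ Ico (n : ℝ) ((n : ℝ) + 1) := (Set.mem_prod.1 hp).1.2
    have hfl : ⌊p.1⌋₊ = n := by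
      rw [Nat.floor_eq_iff ((Nat.cast_nonneg n).trans hp1.1)]
      exact ⟨hp1.1, hp1.2⟩
    simp only [stLift, hθdef, hfl]
  refine ⟨θ, fun T hT => ?_, ⟨fun t ht => ?_, fun t₀ ht₀ => ?_⟩, ?_⟩
  · -- weak solution on `[0,T)`: modify `Θ N`, `N = ⌊T⌋₊`
    have hTN : T ≤ (⌊T⌋₊ : ℝ) + 1 := (Nat.lt_floor_add_one T).le
    exact ((hsol ⌊T⌋₊).mono hTN).congr_ae_slice (hmeas T) (hθae ⌊T⌋₊ hTN)
  · -- slices in `L²`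
    exact ((hcont ⌊t⌋₊).memLp ⟨ht, (Nat.lt_floor_add_one t).le⟩).ae_eq
      (hθN ⌊t⌋₊ t ⟨ht, (Nat.lt_floor_add_one t).le⟩).symm
  · -- strong continuity at `t₀ ≥ 0` within `[0, ∞)`: work on `[0, N+1]`, `N = ⌊t₀⌋₊ + 1`
    set N : ℕ := ⌊t₀⌋₊ + 1 with hN
    have ht₀N : t₀ < (N : ℝ) := by rw [hN]; push_cast; exact Nat.lt_floor_add_one t₀
    have hcN : IsL2ContinuousOn (Icc 0 ((N : ℝ) + 1)) θ :=
      (hcont N).congr_ae_slice fun t ht => hθN N t ht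
    have hlim := hcN.2 t₀ ⟨ht₀, by linarith⟩
    have hnhds : 𝓝[Ici 0] t₀ = 𝓝[Ici 0 ∩ Iio ((N : ℝ) + 1)] t₀ :=
      nhdsWithin_restrict'' (Ici 0) (mem_nhdsWithin_of_mem_nhds (Iio_mem_nhds (show t₀ < (N : ℝ) + 1 by linarith)))
    rw [hnhds]
    exact hlim.mono_left (nhdsWithin_mono _ fun t ht => ⟨ht.1, ht.2.le⟩)
  · -- the datum
    simp only [hθdef, Nat.floor_zero]
    exact h0 0

omit [DecidableEq d] in
/-- A steady `L²` source is square integrable on every slab. [cite: Evans2010, §7.1.1 (f ∈ L²(0,T;L²(U))), §7.1.2 Thm. 2] -/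
theorem memLp_uncurry_const_of_memLp {S : UnitAddTorus d → ℝ} (hS : MemLp S 2 volume) (T : ℝ) :
    MemLp (uncurry fun _ : ℝ => S) 2 (((volume : Measure ℝ).restrict (Ioo 0 T)).prod volume) := by
  refine (FunctionSpaces.Torus.memLp_two_uncurry (θ := fun _ : ℝ => S) hS.1.comp_snd ?_).1
  rw [lintegral_const, Measure.restrict_apply_univ]
  refine ENNReal.mul_lt_top ?_ measure_Ioo_lt_top
  rw [← FunctionSpaces.eLpNorm_two_pow_two_eq_lintegral]
  exact ENNReal.pow_lt_top hS.eLpNorm_lt_top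

omit [DecidableEq d] in
/-- A globally bounded, jointly measurable carrier is in `L^∞` of every slab. [cite: DiPernaLions1989, §II.1 (12)–(14)] -/
theorem memLp_top_stLift_of_bound {b : ℝ → UnitAddTorus d → EuclideanSpace ℝ d}
    (hb : AEStronglyMeasurable (stLift b) volume) {A : ℝ} (hA : ∀ t x, ‖b t x‖ ≤ A) (T : ℝ) :
    MemLp (stLift b) ∞ (volume.restrict (Ioo 0 T ×ˢ univ)) :=
  memLp_top_of_bound hb.restrict A (ae_of_all _ fun p => hA p.1 _)

/-- **Global existence for a steady `L²` source and a bounded carrier** (the setting of the scalar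
zeroth-law statements: a prescribed `κ`-independent stirring field, bounded and weakly divergence
free at every time, and a steady source): there is a global weak solution
`Torus.IsWeakScalarTransportDiagForced a κ b (fun _ => S) θ₀ θ` which is the `L²`-continuous
representative on `[0,∞)` with `θ 0 = θ₀`. [cite: Pazy1983, Ch. 4 §4.2, Cor. 2.5 (inhomogeneous problem), p. 107] -/
theorem exists_isWeakScalarTransportDiagForced_l2Continuous_of_steady (hκ : 0 < κ) (ha : ∀ i, 0 < a i)
    (hθ₀ : MemLp θ₀ 2 volume) {b : ℝ → UnitAddTorus d → EuclideanSpace ℝ d}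
    (hb : AEStronglyMeasurable (stLift b) volume) {A : ℝ} (hA : ∀ t x, ‖b t x‖ ≤ A)
    (hdiv : ∀ t, FunctionSpaces.Torus.IsWeaklyDivFree (b t)) {S : UnitAddTorus d → ℝ} (hS : MemLp S 2 volume) :
    ∃ θ : ℝ → UnitAddTorus d → ℝ, IsWeakScalarTransportDiagForced a κ b (fun _ => S) θ₀ θ ∧
      IsL2ContinuousOn (Ici 0) θ ∧ θ 0 = θ₀ :=
  exists_isWeakScalarTransportDiagForced_l2Continuous hκ ha hθ₀ (memLp_top_stLift_of_bound hb hA)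
    (fun _ => ae_of_all _ fun t => hdiv t) (memLp_uncurry_const_of_memLp hS)

end Global

end Torus

end Literature.Analysis.FluidPDE

end
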